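import Summits.QuantumFields.BalabanUV.Beta.EriceRemainderEnclosureHistoryAutonomyComparisonDualContraction

/-!
# EriceRemainderEnclosureHistoryAutonomyComparisonDualContractionEnd — (E138c) **THE CONTRACTION CLASS IN COUPLING VOCABULARY AND THE (E49k) BRIDGE.**
# Two corollaries of (E138b) `…ComparisonDualContraction.le_of_isotone_excess_moment` (the third, the HINGE DICHOTOMY against (E56a), is (E138d) `…ComparisonDualContractionHinge`):
# (§2) **PER-AGE COUPLING MODULI**: `B u − B v ≤ Σ_{k<K} M_k·(u_k − v_k)⁺` on the box and `Σ_{k<K} k·M_k·c_k³∕2 < 1` with the graded couplings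
# `c_k = (1∕γ² + (k+1)·b)^{−1∕2}` ⟹ comparison for every bounded `B′ ≥ B` with isotone excess (`le_of_isotone_excess_coupling_moment`; the conversion is the
# cube inequality `(u − v)⁺ ≤ (c³∕2)·(1∕v² − 1∕u²)⁺` on `]0,c]`);
# (§3) **THE (E49k) BRIDGE**: by (E38a)'s sharp weight bound `k·c_k³∕2 ≤ γ∕(3√3·b)` the moment condition follows from `M₊·γ < 3√3·b`, `M₊ = Σ_{1≤k<K} M_k` the total
# modulus of the ages `≥ 1` — (E49k)'s threshold with the age-`0` (Markov) weight FREE and NO modulus on `B′` (`le_of_isotone_excess_coupling_threshold`; strict `<`).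
# §1 carries the two elementary conversions (cube inequality one-sided; the level hinge is `1`-Lipschitz antitone, one-sided — used by (E138d)).

Cell `pub-balaban`, β-function sub-cell, BINDER row D4 «RemainderConst leaves for Bałaban's split» (`HOME/BINDER-OWNERS.md`; owner lineage `b2b-balaban-beta-an4`;
this file by co-owner #2 lineage `b2b-balaban-beta-d4-p2`, generation 106), β-FLOW TEAM duty (1), FREEZE (0) honoured (def-free; (E138b) `le_of_isotone_excess_moment`,
node U2's `Sharpness.abs_sub_le_half_cube_mul`, (E38a) `…AutonomyThreshold.weight_sharp_le` ∕ `le_inv_sqrt_of_le_inv_sq` BY NAME; nothing restated).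

HONEST FRAMING (page 1, verbatim and binding).  *"Discharging BetaPertH makes Bałaban's UV stability UNCONDITIONAL — a real constructive-QFT result; it is
NOT the continuum limit and NOT the Clay problem."*  THIS FILE DISCHARGES NOTHING OF THE KIND.  Elementary real analysis about ABSTRACT functionals on a box
]0,γ]^ℕ — hypotheses of a census, not facts; nothing about Bałaban's (1.22) limit functional is PRINTED in this form ([I] p. 298; GAPS G-t4-U2-1∕-2) or asserted.
Row D4 class UNCHANGED (critical-path width 0; instance 0∕1; D4 DISCHARGE NO DATE).  NOT B12 Thm 2, NOT BetaPertH, NOT continuum YM, NOT Clay.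

WHAT IS PROVED ([folklore]; 0 `def`, 0 sorry).  §1 `posPart_sub_le_half_cube_mul`, `hinge_sub_hinge_le`.  §2 **`le_of_isotone_excess_coupling_moment`**.
§3 `age_weight_le`, **`le_of_isotone_excess_coupling_threshold`**.
-/
noncomputable section
open Finset Set

namespace Summit.QuantumFields.BalabanUV.Beta.EriceRemainderEnclosureHistoryAutonomyComparisonDualContractionEnd

open Literature.MathematicalPhysics.QuantumFieldTheory.Balaban1983to89
open Literature.MathematicalPhysics.QuantumFieldTheory.Balaban1983to89.T4BetaStationary
open Literature.MathematicalPhysics.QuantumFieldTheory.Balaban1983to89.T4BetaFlowWellPosed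
open Literature.MathematicalPhysics.QuantumFieldTheory.Balaban1983to89.T4BetaFlowWellPosed.Sharpness (abs_sub_le_half_cube_mul)
open Summit.QuantumFields.BalabanUV.Beta.EriceRemainderEnclosureHistoryAutonomyThreshold (weight_sharp_le le_inv_sqrt_of_le_inv_sq)
open Summit.QuantumFields.BalabanUV.Beta.EriceRemainderEnclosureHistoryAutonomyComparisonDualContraction (le_of_isotone_excess_moment)

variable {B B' : (ℕ → ℝ) → ℝ} {M γ b : ℝ} {h h' : ℕ → ℝ}

/-! ## §1 Two elementary conversions -/

/-- THE CUBE CONVERSION, ONE-SIDED: for couplings `0 < u, v ≤ c`, `(u − v)⁺ ≤ (c³∕2)·(1∕v² − 1∕u²)⁺` — a coupling modulus at an age whose couplings stay below `c`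
is a LEVEL modulus `c³∕2` times as large (node U2's `abs_sub_le_half_cube_mul`). [folklore] -/
theorem posPart_sub_le_half_cube_mul {u v c : ℝ} (hu : 0 < u) (hv : 0 < v) (huc : u ≤ c) (hvc : v ≤ c) :
    max (u - v) 0 ≤ c ^ 3 / 2 * max (1 / v ^ 2 - 1 / u ^ 2) 0 := by
  have hc : 0 < c := hu.trans_le huc
  rcases le_or_gt u v with hle | hlt
  · rw [max_eq_right (by linarith)]
    exact mul_nonneg (by positivity) (le_max_right _ _)
  · have h1 : 0 ≤ 1 / v ^ 2 - 1 / u ^ 2 :=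
      sub_nonneg.mpr (one_div_le_one_div_of_le (pow_pos hv 2) (pow_le_pow_left₀ hv.le hlt.le 2))
    rw [max_eq_left (by linarith), max_eq_left h1]
    have h2 := abs_sub_le_half_cube_mul hu hv huc hvc
    rwa [abs_of_pos (by linarith), abs_sub_comm, abs_of_nonneg h1] at h2

/-- THE LEVEL HINGE IS `1`-LIPSCHITZ AND ANTITONE IN THE LEVEL, ONE-SIDED: `max(1 − a, 0) − max(1 − a′, 0) ≤ (a′ − a)⁺`. [folklore] -/
theorem hinge_sub_hinge_le (a a' : ℝ) : max (1 - a) 0 - max (1 - a') 0 ≤ max (a' - a) 0 := by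
  rcases le_or_gt a a' with hle | hlt
  · rw [max_eq_left (by linarith : (0 : ℝ) ≤ a' - a)]
    have := abs_max_sub_max_le_abs (1 - a) (1 - a') 0
    rw [show 1 - a - (1 - a') = a' - a by ring, abs_of_nonneg (by linarith : (0 : ℝ) ≤ a' - a)] at this
    exact (le_abs_self _).trans this
  · rw [max_eq_right (by linarith : a' - a ≤ 0)]
    linarith [max_le_max (by linarith : 1 - a ≤ 1 - a') (le_refl (0 : ℝ))]

/-! ## §2 Per-age coupling moduli -/

/-- **COMPARISON FOR PER-AGE COUPLING MODULI WITH GRADED AGE MOMENT BELOW ONE.**  `B` isotone on `]0,γ]^ℕ` with a zeroth moment `M`, floor `b > 0`, and PER-AGE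
COUPLING MODULI `M_k ≥ 0`: `B u − B v ≤ Σ_{k<K} M_k·(u_k − v_k)⁺` on the box; with the graded couplings `c_k = (1∕γ² + (k+1)·b)^{−1∕2}` (the largest coupling any orbit
tail can show at age `k`) suppose **`Σ_{k<K} k·M_k·c_k³∕2 < 1`**.  Then for EVERY `B′` with `B ≤ B′ ≤ β̄` on the box and ISOTONE excess, and any box solutions `h`, `h′`
of `B`, `B′` from one pin: `h′ ≤ h` at every scale.  ((E138b) with `Λ_k = M_k·c_k³∕2` via §1.) [folklore] -/
theorem le_of_isotone_excess_coupling_moment {Mk : ℕ → ℝ} {K : ℕ} {βb p : ℝ}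
    (hmono : ∀ u v : ℕ → ℝ, SeqBox γ u → SeqBox γ v → (∀ i, u i ≤ v i) → B u ≤ B v)
    (hB : ∀ u u' : ℕ → ℝ, SeqBox γ u → SeqBox γ u' → ∀ D : ℝ, (∀ j, |u j - u' j| ≤ D) → |B u - B u'| ≤ M * D) (hM : 0 ≤ M)
    (hb : 0 < b) (hlo : ∀ u, SeqBox γ u → b ≤ B u) (hMk : ∀ k, 0 ≤ Mk k)
    (hLipC : ∀ u v : ℕ → ℝ, SeqBox γ u → SeqBox γ v → B u - B v ≤ ∑ k ∈ range K, Mk k * max (u k - v k) 0)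
    (hθ : ∑ k ∈ range K, (k : ℝ) * (Mk k * (1 / Real.sqrt (1 / γ ^ 2 + ((k : ℝ) + 1) * b)) ^ 3 / 2) < 1)
    (hexc : ∀ u, SeqBox γ u → B u ≤ B' u) (hbdd : ∀ u, SeqBox γ u → B' u ≤ βb)
    (hDmono : ∀ u v : ℕ → ℝ, SeqBox γ u → SeqBox γ v → (∀ i, u i ≤ v i) → B' u - B u ≤ B' v - B v)
    (hp : 0 < p) (hpγ : p ≤ γ) (hh : SeqBox γ h) (hf : MemFlow B p h) (hh' : SeqBox γ h') (hf' : MemFlow B' p h') (j : ℕ) :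
    h' j ≤ h j := by
  have hγ : 0 < γ := hp.trans_le hpγ
  refine le_of_isotone_excess_moment (Λ := fun k => Mk k * (1 / Real.sqrt (1 / γ ^ 2 + ((k : ℝ) + 1) * b)) ^ 3 / 2)
    hmono hB hM hb hlo (fun k => by have := hMk k; positivity) hθ ?_ hexc hbdd hDmono hp hpγ hh hf hh' hf' j
  intro u v hu hv hgu hgv
  refine (hLipC u v hu hv).trans (sum_le_sum fun k _ => ?_)
  have hP : 0 < 1 / γ ^ 2 + ((k : ℝ) + 1) * b := by positivity
  have huc : u k ≤ 1 / Real.sqrt (1 / γ ^ 2 + ((k : ℝ) + 1) * b) := le_inv_sqrt_of_le_inv_sq (hu k).1 hP (hgu k)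
  have hvc : v k ≤ 1 / Real.sqrt (1 / γ ^ 2 + ((k : ℝ) + 1) * b) := le_inv_sqrt_of_le_inv_sq (hv k).1 hP (hgv k)
  have hconv := mul_le_mul_of_nonneg_left (posPart_sub_le_half_cube_mul (hu k).1 (hv k).1 huc hvc) (hMk k)
  calc Mk k * max (u k - v k) 0
      ≤ Mk k * ((1 / Real.sqrt (1 / γ ^ 2 + ((k : ℝ) + 1) * b)) ^ 3 / 2 * max (1 / v k ^ 2 - 1 / u k ^ 2) 0) := hconv
    _ = Mk k * (1 / Real.sqrt (1 / γ ^ 2 + ((k : ℝ) + 1) * b)) ^ 3 / 2 * max (1 / v k ^ 2 - 1 / u k ^ 2) 0 := by ring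

/-! ## §3 The (E49k) bridge: total modulus of the ages `≥ 1` below `3√3·b∕γ` -/

/-- THE AGE WEIGHT: `k·c_k³∕2 ≤ γ∕(3√3·b)` for the graded coupling `c_k = (1∕γ² + (k+1)·b)^{−1∕2}` — (E38a) `weight_sharp_le` at `k`, after `c_k ≤ (1∕γ² + k·b)^{−1∕2}`.
[folklore] -/
theorem age_weight_le (hγ : 0 < γ) (hb : 0 < b) (k : ℕ) :
    (k : ℝ) * ((1 / Real.sqrt (1 / γ ^ 2 + ((k : ℝ) + 1) * b)) ^ 3 / 2) ≤ γ / (3 * Real.sqrt 3 * b) := by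
  have hw := weight_sharp_le hγ hb k
  have hP : 0 < 1 / γ ^ 2 + (k : ℝ) * b := by positivity
  have hPP : 1 / γ ^ 2 + (k : ℝ) * b ≤ 1 / γ ^ 2 + ((k : ℝ) + 1) * b := by nlinarith
  have hs : Real.sqrt (1 / γ ^ 2 + (k : ℝ) * b) ≤ Real.sqrt (1 / γ ^ 2 + ((k : ℝ) + 1) * b) := Real.sqrt_le_sqrt hPP
  have hs0 : 0 < Real.sqrt (1 / γ ^ 2 + (k : ℝ) * b) := Real.sqrt_pos.mpr hP
  have hc : 1 / Real.sqrt (1 / γ ^ 2 + ((k : ℝ) + 1) * b) ≤ 1 / Real.sqrt (1 / γ ^ 2 + (k : ℝ) * b) :=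
    one_div_le_one_div_of_le hs0 hs
  have hc0 : 0 ≤ 1 / Real.sqrt (1 / γ ^ 2 + ((k : ℝ) + 1) * b) := by positivity
  have hcube : (1 / Real.sqrt (1 / γ ^ 2 + ((k : ℝ) + 1) * b)) ^ 3 ≤ (1 / Real.sqrt (1 / γ ^ 2 + (k : ℝ) * b)) ^ 3 :=
    pow_le_pow_left₀ hc0 hc 3
  have := mul_le_mul_of_nonneg_left (div_le_div_of_nonneg_right hcube (by norm_num : (0 : ℝ) ≤ 2)) (Nat.cast_nonneg k)
  exact this.trans hw

/-- **THE (E49k) BRIDGE — ISOTONE MEMORY WITH PER-AGE MODULI BELOW THE THRESHOLD COMPARES, AGE `0` FREE, NO MODULUS ON `B′`.**  `B` isotone on `]0,γ]^ℕ`, zeroth moment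
`M`, floor `b > 0`, per-age coupling moduli `M_k ≥ 0` (`B u − B v ≤ Σ_{k<K} M_k·(u_k − v_k)⁺`) whose total over the ages `k ≥ 1` satisfies **`M₊·γ < 3√3·b`**,
`M₊ = Σ_{k<K, k≠0} M_k`; `B′` ANY functional with `B ≤ B′ ≤ β̄` on the box and isotone excess.  Then `h′ ≤ h` at every scale from every pin for any box solutions.
Compared with (E49k) `le_of_isotone_excess` (sup-modulus `M`, `M·γ ≤ 3√3·b`, `B′` with a modulus): the Markov weight `M_0` does not count and `B′` needs no modulus; the
inequality is strict. [folklore] -/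
theorem le_of_isotone_excess_coupling_threshold {Mk : ℕ → ℝ} {K : ℕ} {βb p : ℝ}
    (hmono : ∀ u v : ℕ → ℝ, SeqBox γ u → SeqBox γ v → (∀ i, u i ≤ v i) → B u ≤ B v)
    (hB : ∀ u u' : ℕ → ℝ, SeqBox γ u → SeqBox γ u' → ∀ D : ℝ, (∀ j, |u j - u' j| ≤ D) → |B u - B u'| ≤ M * D) (hM : 0 ≤ M)
    (hb : 0 < b) (hlo : ∀ u, SeqBox γ u → b ≤ B u) (hMk : ∀ k, 0 ≤ Mk k)
    (hLipC : ∀ u v : ℕ → ℝ, SeqBox γ u → SeqBox γ v → B u - B v ≤ ∑ k ∈ range K, Mk k * max (u k - v k) 0)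
    (hsmall : (∑ k ∈ range K, if k = 0 then 0 else Mk k) * γ < 3 * Real.sqrt 3 * b)
    (hexc : ∀ u, SeqBox γ u → B u ≤ B' u) (hbdd : ∀ u, SeqBox γ u → B' u ≤ βb)
    (hDmono : ∀ u v : ℕ → ℝ, SeqBox γ u → SeqBox γ v → (∀ i, u i ≤ v i) → B' u - B u ≤ B' v - B v)
    (hp : 0 < p) (hpγ : p ≤ γ) (hh : SeqBox γ h) (hf : MemFlow B p h) (hh' : SeqBox γ h') (hf' : MemFlow B' p h') (j : ℕ) :
    h' j ≤ h j := by
  have hγ : 0 < γ := hp.trans_le hpγ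
  have h33 : 0 < 3 * Real.sqrt 3 * b := by positivity
  refine le_of_isotone_excess_coupling_moment hmono hB hM hb hlo hMk hLipC ?_ hexc hbdd hDmono hp hpγ hh hf hh' hf' j
  -- termwise: k·M_k·c_k³∕2 ≤ [k ≠ 0]·M_k·γ∕(3√3·b)
  have hterm : ∀ k ∈ range K, (k : ℝ) * (Mk k * (1 / Real.sqrt (1 / γ ^ 2 + ((k : ℝ) + 1) * b)) ^ 3 / 2)
      ≤ (if k = 0 then 0 else Mk k) * (γ / (3 * Real.sqrt 3 * b)) := by
    intro k _
    split_ifs with hk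
    · subst hk; simp
    · have hw := mul_le_mul_of_nonneg_left (age_weight_le hγ hb k) (hMk k)
      calc (k : ℝ) * (Mk k * (1 / Real.sqrt (1 / γ ^ 2 + ((k : ℝ) + 1) * b)) ^ 3 / 2)
          = Mk k * ((k : ℝ) * ((1 / Real.sqrt (1 / γ ^ 2 + ((k : ℝ) + 1) * b)) ^ 3 / 2)) := by ring
        _ ≤ Mk k * (γ / (3 * Real.sqrt 3 * b)) := hw
  have hsum := sum_le_sum hterm
  rw [← sum_mul] at hsum
  have hlt : (∑ k ∈ range K, if k = 0 then 0 else Mk k) * (γ / (3 * Real.sqrt 3 * b)) < 1 := by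
    rw [← mul_div_assoc, div_lt_one h33]
    exact hsmall
  exact hsum.trans_lt hlt

end Summit.QuantumFields.BalabanUV.Beta.EriceRemainderEnclosureHistoryAutonomyComparisonDualContractionEnd

end
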